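import Literature.MathematicalPhysics.QuantumLattice.FreeFermiGasPairingCost
import Literature.MathematicalPhysics.QuantumLattice.TorusShellCountDyadic
import HarnessLib

/-!
# `d`-wave pair LRO of the free Fermi sea costs kinetic energy: the QUADRATIC rate

Family `hubbard` / topic `MathematicalPhysics/QuantumLattice`; sharpening of
`FreeFermiGasPairingCost.lean`. THEOREM (`freeDWavePairing_costs_energy_sharp_rate`): for every LRO
density `a > 0`, all sides `L ≥ ⌈1216/a⌉ + 3`, every `N` and every unit vector `ψ` of the sector
`szSector N 0` of the fermionic torus `(ℤ/Lℤ)²` with `Re ⟨ψ, Δ_d†Δ_d ψ⟩ ≥ a·L⁴`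
(`Δ_d = pairField dWaveFormFactor L`):

  `minEnergyOn H₀ (szSector N 0) + (min(a,1)/8192)² · L² ≤ Re ⟨ψ, H₀ ψ⟩`,  `H₀ = hubbardTorus 2 L 1 0`,

i.e. the rate `η(a)` at which `d`-wave pair order costs free kinetic energy is QUADRATIC in the
order density (the companion file has the sextic rate `4(min(a,1)/48)⁶`). Quadratic is the optimal
power of the method (pair Gram bounds `|⟨b_k† b_k'⟩| ≤ t_k t_k'`, `t_k⁴ ≤ x_k(1-x_k)`, against the
bathtub cost `Σ_k |ε_k - ε_F| x_k(1-x_k)`): the extremal profile is `t_k ∝ |ε_k - ε_F|^{-1/3}`, for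
which `Σ_k t_k ≍ X^{1/4} (Σ_k |ε_k - ε_F|^{-1/3})^{3/4} ≍ X^{1/4} L^{3/2}` (Hölder with exponents
`4, 4/3`; the lattice sum `Σ |ξ|^{-1/3}` converges at the Fermi surface even at the van Hove level).

Route (elementary, dyadic): with a scale `θ ∈ (0,1]`,
1. base shell `|ε_k - ε_F| ≤ θ⁶`: `t_k ≤ 1` and the uniform count `≤ θ³L² + 2L`
   (`card_torusShell_le_sqrt`);
2. dyadic shells `64^m θ⁶ ≤ |ε_k - ε_F| < 64^{m+1} θ⁶`: Young `4λ_m³ t ≤ t⁴ + 3λ_m⁴` at the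
   SCALE-DEPENDENT parameter `λ_m = λ/4^m`, so that `t_k ≤ |ξ_k| x_k(1-x_k)/(4λ³θ⁶) + (3/4)λ·4^{-m}`;
3. the weights sum geometrically: `Σ_m 4^{-m} #shell_m ≤ (40/3)θ²L² + (8/3)L`
   (`sum_geomWeight_card_shell_le`, `TorusShellCountDyadic.lean`);
4. hence `Σ_k t_k ≤ θ³L² + 2L + X/(4λ³θ⁶) + λ(10θ²L² + 2L)` (`sum_quarticMean_le_sharp`); at
   `λ = θ/2` and `X ≤ θ¹²L²`: `Σ t ≤ 8θ³L² + 3L`, so `Re⟨Δ_d†Δ_d⟩ ≤ 32L² + 32(Σ t)² ≤ 4096θ⁶L⁴ + 608L²`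
   — impossible for `a ≥ 8192θ⁶`, `aL > 1216` (`freeDWavePairing_costs_energy_sharp_scale`);
5. `θ⁶ = min(a,1)/8192` gives `η(a) = θ¹² = (min(a,1)/8192)²` (`…_sharp_explicit`, `…_sharp_rate`)
   and the a-priori form `re_expect_pairField_dWave_lt_of_energy_excess_le`.

Downstream (separate files): the coupling floor for the ground-state `d`-wave pair density of the
repulsive Hubbard torus improves from `4(min(c,1)/48)⁶ ≤ U` to `(min(c,1)/8192)² ≤ U`, i.e. the
density is `≤ 8192·√U` (`HubbardPairDensityCouplingFloorSharp.lean`), and likewise the window floor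
of crux `BirGroundStateAverageLRO` (route `HubbardSuperconductivity/BalabanIR`, Summits side).

Sources: J. Bardeen, L. N. Cooper, J. R. Schrieffer, Phys. Rev. 108 (1957) 1175, §II; C. N. Yang,
Rev. Mod. Phys. 34 (1962) 694, §3. Folklore finite-dimensional statements; no named facts, no
definitions.

## Mathlib / tree search

Tree: `sum_quarticMean_le` (sextic companion), `four_mul_cube_mul_le`, `re_expect_pairField_dWave_le`,
`sum_abs_sub_fermiLevel_mul_le_energy_excess`, `card_torusShell_le_sqrt`,
`sum_geomWeight_card_shell_le`, `exists_eq_two_mul_of_mem_szSector_zero`. Mathlib: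
`exists_nat_pow_near`, `pow_unbounded_of_one_lt`, `Finset.sum_boole`, `Real.rpow_le_one`,
`Real.rpow_mul`.
-/

noncomputable section

namespace Literature.MathematicalPhysics.QuantumLattice

open Matrix Finset Literature.Probability.LatticeModels
open scoped ComplexOrder ComplexConjugate

/-! ### The quartic means are controlled by the energy excess: sharp form -/

section Shell

variable {L : ℕ} [NeZero L]

/-- **Sharp control of the quartic means by the energy excess.** For `L ≥ 3`, a unit
`ψ ∈ szSector (2n) 0`, a scale `θ ∈ (0, 1]` and a Young parameter `λ > 0`:
`Σ_k t_k ≤ θ³L² + 2L + X/(4λ³θ⁶) + λ(10 θ² L² + 2L)`,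
`X = Re⟨ψ,H₀ψ⟩ - minEnergyOn H₀ (szSector (2n) 0)`, `t_k⁴ = u_k v_k ≤ x_k(1-x_k)`: on the base shell
`|ε_k - ε_F| ≤ θ⁶` use `t_k ≤ 1` and the uniform shell count; on the dyadic shell
`64^m θ⁶ ≤ |ε_k - ε_F| < 64^{m+1} θ⁶` use Young's inequality `4λ_m³ t ≤ t⁴ + 3λ_m⁴` at the
SCALE-DEPENDENT parameter `λ_m = λ/4^m` (so that `t⁴/(4λ_m³) ≤ |ε_k - ε_F| x_k(1-x_k)/(4λ³θ⁶)`),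
and sum the weights `(3/4)λ 4^{-m}` with `sum_geomWeight_card_shell_le`. This realises the Hölder
pairing `Σ t ≤ (Σ |ξ| t⁴)^{1/4} (Σ |ξ|^{-1/3})^{3/4}` with dyadic constants. [folklore] -/
theorem sum_quarticMean_le_sharp (hL : 3 ≤ L) {n : ℕ} {ψ : Fock (Orb (FermionTorus 2 L))}
    (hψ : ψ ∈ szSector (Λ := FermionTorus 2 L) (2 * n) 0) (h1 : star ψ ⬝ᵥ ψ = 1)
    {θ lam : ℝ} (hθ : 0 < θ) (hθ1 : θ ≤ 1) (hlam : 0 < lam) :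
    ∑ k : TorusSite 2 L, Real.sqrt (Real.sqrt
        ((star ψ ⬝ᵥ ((momentumNumber k 0 * momentumNumber (-k) 1) *ᵥ ψ)).re *
          (star ψ ⬝ᵥ (((1 - momentumNumber k 0) * (1 - momentumNumber (-k) 1)) *ᵥ ψ)).re)) ≤
      θ ^ 3 * (L : ℝ) ^ 2 + 2 * L +
        ((star ψ ⬝ᵥ (hubbardTorus 2 L 1 0 *ᵥ ψ)).re -
            (hubbardTorus 2 L 1 0).minEnergyOn (szSector (Λ := FermionTorus 2 L) (2 * n) 0)) /
          (4 * lam ^ 3 * θ ^ 6) +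
        lam * (10 * θ ^ 2 * (L : ℝ) ^ 2 + 2 * L) := by
  obtain ⟨eF, hD⟩ := sum_abs_sub_fermiLevel_mul_le_energy_excess hL hψ h1
  set X : ℝ := (star ψ ⬝ᵥ (hubbardTorus 2 L 1 0 *ᵥ ψ)).re -
    (hubbardTorus 2 L 1 0).minEnergyOn (szSector (Λ := FermionTorus 2 L) (2 * n) 0) with hX
  set x : TorusSite 2 L → ℝ := fun k => (star ψ ⬝ᵥ (momentumNumber k 0 *ᵥ ψ)).re with hx
  set u : TorusSite 2 L → ℝ := fun k =>
    (star ψ ⬝ᵥ ((momentumNumber k 0 * momentumNumber (-k) 1) *ᵥ ψ)).re with hu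
  set v : TorusSite 2 L → ℝ := fun k =>
    (star ψ ⬝ᵥ (((1 - momentumNumber k 0) * (1 - momentumNumber (-k) 1)) *ᵥ ψ)).re with hv
  set t : TorusSite 2 L → ℝ := fun k => Real.sqrt (Real.sqrt (u k * v k)) with ht
  change ∑ k, |torusBand L k - eF| * (x k * (1 - x k)) ≤ X at hD
  have hx1 : ∀ k, x k ≤ 1 := fun k => by
    have := (re_expect_momentumNumber_mem_Icc k 0 ψ).2
    rwa [h1, Complex.one_re] at this
  have hu0 : ∀ k, 0 ≤ u k := fun k => (re_expect_pairPresent_mem_Icc k ψ).1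
  have hux : ∀ k, u k ≤ x k := fun k => (re_expect_pairPresent_mem_Icc k ψ).2
  have hv0 : ∀ k, 0 ≤ v k := fun k => (re_expect_pairAbsent_mem_Icc k ψ).1
  have hvx : ∀ k, v k ≤ 1 - x k := fun k => by
    have := (re_expect_pairAbsent_mem_Icc k ψ).2
    rwa [h1, Complex.one_re] at this
  have ht0 : ∀ k, 0 ≤ t k := fun k => Real.sqrt_nonneg _
  have ht4 : ∀ k, t k ^ 4 = u k * v k := fun k => by
    rw [show t k ^ 4 = (t k ^ 2) ^ 2 by ring, ht]
    simp only
    rw [Real.sq_sqrt (Real.sqrt_nonneg _), Real.sq_sqrt (mul_nonneg (hu0 k) (hv0 k))]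
  have huv : ∀ k, u k * v k ≤ x k * (1 - x k) := fun k =>
    mul_le_mul (hux k) (hvx k) (hv0 k) ((hu0 k).trans (hux k))
  have hx0 : ∀ k, 0 ≤ x k := fun k => (re_expect_momentumNumber_mem_Icc k 0 ψ).1
  have hxx : ∀ k, 0 ≤ x k * (1 - x k) := fun k => mul_nonneg (hx0 k) (by linarith [hx1 k])
  have ht1 : ∀ k, t k ≤ 1 := fun k => by
    have hle : u k * v k ≤ 1 := (huv k).trans (by nlinarith [hx0 k, hx1 k])
    have := Real.sqrt_le_sqrt (Real.sqrt_le_sqrt hle)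
    rwa [Real.sqrt_one, Real.sqrt_one] at this
  have hθ6 : 0 < θ ^ 6 := by positivity
  -- the base shell `|ε_k - ε_F| ≤ θ⁶` and the dyadic shells `64^m θ⁶ ≤ |ε_k - ε_F| < 64^(m+1) θ⁶`
  set S : Finset (TorusSite 2 L) := Finset.univ.filter fun k => |torusBand L k - eF| ≤ θ ^ 6 with hS
  set A : ℕ → Finset (TorusSite 2 L) := fun m => Finset.univ.filter fun k : TorusSite 2 L =>
      (64 : ℝ) ^ m * θ ^ 6 ≤ |torusBand L k - eF| ∧
        |torusBand L k - eF| < (64 : ℝ) ^ (m + 1) * θ ^ 6 with hA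
  -- a uniform number of shells
  obtain ⟨M, hM⟩ := pow_unbounded_of_one_lt
    ((∑ k : TorusSite 2 L, |torusBand L k - eF|) / θ ^ 6) (by norm_num : (1 : ℝ) < 64)
  rw [← Finset.sum_add_sum_compl S]
  -- on the base shell: `t ≤ 1` and the uniform shell count
  have hshell : ∑ k ∈ S, t k ≤ θ ^ 3 * (L : ℝ) ^ 2 + 2 * L := by
    calc ∑ k ∈ S, t k ≤ ∑ _k ∈ S, (1 : ℝ) := Finset.sum_le_sum fun k _ => ht1 k
      _ = S.card := by rw [Finset.sum_const, nsmul_eq_mul, mul_one]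
      _ ≤ Real.sqrt (θ ^ 6) * (L : ℝ) ^ 2 + 2 * L := card_torusShell_le_sqrt eF (θ ^ 6)
      _ = θ ^ 3 * (L : ℝ) ^ 2 + 2 * L := by
          rw [show θ ^ 6 = (θ ^ 3) ^ 2 by ring, Real.sqrt_sq (by positivity)]
  -- the geometric shell weight of a momentum
  set W : TorusSite 2 L → ℝ := fun k =>
    ∑ m ∈ Finset.range M, (1 / 4 : ℝ) ^ m * (if k ∈ A m then (1 : ℝ) else 0) with hW
  have hW0 : ∀ k, 0 ≤ W k := fun k =>
    Finset.sum_nonneg fun m _ => mul_nonneg (by positivity) (by split_ifs <;> norm_num)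
  -- off the base shell: Young's inequality at the scale of the shell
  have hfar : ∀ k ∈ Sᶜ, t k ≤ |torusBand L k - eF| * (x k * (1 - x k)) / (4 * lam ^ 3 * θ ^ 6) +
      3 / 4 * lam * W k := by
    intro k hk
    have hkw : θ ^ 6 < |torusBand L k - eF| := by
      rw [Finset.mem_compl, hS, Finset.mem_filter, not_and] at hk
      exact not_le.1 (hk (Finset.mem_univ k))
    obtain ⟨m, hm1, hm2⟩ := exists_nat_pow_near (x := |torusBand L k - eF| / θ ^ 6)
      (y := (64 : ℝ)) (by rw [le_div_iff₀ hθ6]; linarith) (by norm_num)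
    have h64m : (64 : ℝ) ^ m * θ ^ 6 ≤ |torusBand L k - eF| := by rwa [le_div_iff₀ hθ6] at hm1
    have hkA : k ∈ A m := by
      simp only [hA, Finset.mem_filter, Finset.mem_univ, true_and]
      exact ⟨h64m, by rwa [div_lt_iff₀ hθ6] at hm2⟩
    have hmM : m < M := by
      have hle : |torusBand L k - eF| / θ ^ 6 ≤
          (∑ k' : TorusSite 2 L, |torusBand L k' - eF|) / θ ^ 6 :=
        div_le_div_of_nonneg_right (Finset.single_le_sum
          (fun k' _ => abs_nonneg (torusBand L k' - eF)) (Finset.mem_univ k)) hθ6.le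
      have : (64 : ℝ) ^ m < 64 ^ M := lt_of_le_of_lt (hm1.trans hle) hM
      exact (pow_lt_pow_iff_right₀ (by norm_num : (1 : ℝ) < 64)).1 this
    have hWm : (1 / 4 : ℝ) ^ m ≤ W k := by
      have := Finset.single_le_sum (s := Finset.range M)
        (f := fun m' => (1 / 4 : ℝ) ^ m' * (if k ∈ A m' then (1 : ℝ) else 0))
        (fun m' _ => mul_nonneg (by positivity) (by split_ifs <;> norm_num)) (Finset.mem_range.2 hmM)
      rw [if_pos hkA, mul_one] at this
      exact this
    -- Young at scale `μ = λ / 4^m`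
    set μ : ℝ := lam / 4 ^ m with hμ
    have hμ0 : 0 < μ := by positivity
    have hyoung := four_mul_cube_mul_le (t k) μ
    have ht_le : t k * (4 * μ ^ 3) ≤ t k ^ 4 + 3 * μ ^ 4 := by linarith
    have h64 : μ ^ 3 * (64 : ℝ) ^ m = lam ^ 3 := by
      have h4 : (4 : ℝ) ^ m ≠ 0 := by positivity
      rw [hμ, div_pow, show (64 : ℝ) ^ m = ((4 : ℝ) ^ m) ^ 3 by
        rw [← pow_mul, show (64 : ℝ) = 4 ^ 3 by norm_num, ← pow_mul, mul_comm]]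
      field_simp
    -- `t⁴ ≤ |ξ| x(1-x) / (64^m θ⁶)`, so `t⁴/(4μ³) ≤ |ξ| x(1-x)/(4λ³θ⁶)`
    have h4 : t k ^ 4 ≤ |torusBand L k - eF| * (x k * (1 - x k)) / (4 * lam ^ 3 * θ ^ 6) *
        (4 * μ ^ 3) := by
      rw [div_mul_eq_mul_div, le_div_iff₀ (by positivity)]
      calc t k ^ 4 * (4 * lam ^ 3 * θ ^ 6)
          = (u k * v k) * ((64 : ℝ) ^ m * θ ^ 6) * (4 * μ ^ 3) := by rw [ht4 k, ← h64]; ring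
        _ ≤ (x k * (1 - x k)) * |torusBand L k - eF| * (4 * μ ^ 3) := by
            apply mul_le_mul_of_nonneg_right _ (by positivity)
            exact mul_le_mul (huv k) h64m (by positivity) (hxx k)
        _ = |torusBand L k - eF| * (x k * (1 - x k)) * (4 * μ ^ 3) := by ring
    -- `(3/4) μ ≤ (3/4) λ W k`
    have h34 : 3 * μ ^ 4 ≤ 3 / 4 * lam * W k * (4 * μ ^ 3) := by
      have hμW : μ ≤ lam * W k := by
        rw [hμ]
        have : lam / 4 ^ m = lam * (1 / 4 : ℝ) ^ m := by rw [one_div, inv_pow, div_eq_mul_inv]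
        rw [this]
        exact mul_le_mul_of_nonneg_left hWm hlam.le
      have hμ3 : 0 ≤ μ ^ 3 := by positivity
      nlinarith
    have hsum : t k * (4 * μ ^ 3) ≤ (|torusBand L k - eF| * (x k * (1 - x k)) / (4 * lam ^ 3 * θ ^ 6) +
        3 / 4 * lam * W k) * (4 * μ ^ 3) := by
      rw [add_mul]; linarith
    exact le_of_mul_le_mul_right hsum (by positivity)
  -- the shell weights sum to `O(θ² L² + L)`
  have hWsum : ∑ k ∈ Sᶜ, W k ≤ 40 / 3 * θ ^ 2 * (L : ℝ) ^ 2 + 8 / 3 * L := by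
    calc ∑ k ∈ Sᶜ, W k ≤ ∑ k, W k := Finset.sum_le_univ_sum_of_nonneg hW0
      _ = ∑ m ∈ Finset.range M, (1 / 4 : ℝ) ^ m * ((A m).card : ℝ) := by
          rw [hW, Finset.sum_comm]
          refine Finset.sum_congr rfl fun m _ => ?_
          rw [← Finset.mul_sum, Finset.sum_boole, Finset.filter_mem_eq_inter, Finset.univ_inter]
      _ ≤ _ := sum_geomWeight_card_shell_le hθ hθ1 eF M
  -- off the base shell, summed
  have hoff : ∑ k ∈ Sᶜ, t k ≤ X / (4 * lam ^ 3 * θ ^ 6) +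
      3 / 4 * lam * (40 / 3 * θ ^ 2 * (L : ℝ) ^ 2 + 8 / 3 * L) := by
    calc ∑ k ∈ Sᶜ, t k
        ≤ ∑ k ∈ Sᶜ, (|torusBand L k - eF| * (x k * (1 - x k)) / (4 * lam ^ 3 * θ ^ 6) +
            3 / 4 * lam * W k) := Finset.sum_le_sum hfar
      _ = (∑ k ∈ Sᶜ, |torusBand L k - eF| * (x k * (1 - x k))) / (4 * lam ^ 3 * θ ^ 6) +
            3 / 4 * lam * ∑ k ∈ Sᶜ, W k := by
          rw [Finset.sum_add_distrib, Finset.sum_div, Finset.mul_sum]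
      _ ≤ X / (4 * lam ^ 3 * θ ^ 6) + 3 / 4 * lam * (40 / 3 * θ ^ 2 * (L : ℝ) ^ 2 + 8 / 3 * L) := by
          have hsub : ∑ k ∈ Sᶜ, |torusBand L k - eF| * (x k * (1 - x k)) ≤ X :=
            (Finset.sum_le_univ_sum_of_nonneg fun k => mul_nonneg (abs_nonneg _) (hxx k)).trans hD
          have h1' := div_le_div_of_nonneg_right hsub (by positivity : (0 : ℝ) ≤ 4 * lam ^ 3 * θ ^ 6)
          have h2' := mul_le_mul_of_nonneg_left hWsum (by positivity : (0 : ℝ) ≤ 3 / 4 * lam)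
          linarith
  have hring : 3 / 4 * lam * (40 / 3 * θ ^ 2 * (L : ℝ) ^ 2 + 8 / 3 * L) =
      lam * (10 * θ ^ 2 * (L : ℝ) ^ 2 + 2 * L) := by ring
  linarith

end Shell

/-! ### Assembly: the quadratic rate -/

section Assembly

variable {L : ℕ} [NeZero L]

/-- **`d`-wave pair LRO costs kinetic energy — sharp rate, scale form.** For a scale `θ ∈ (0,1]`,
`L ≥ 3`, an LRO density `a ≥ 8192·θ⁶` with `a·L > 1216`, and a unit vector `ψ ∈ szSector (2n) 0`
with `Re ⟨ψ, Δ_d†Δ_d ψ⟩ ≥ a·L⁴`: `minEnergyOn H₀ (szSector (2n) 0) + θ¹²·L² < Re ⟨ψ, H₀ ψ⟩`,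
`H₀ = hubbardTorus 2 L 1 0` (`sum_quarticMean_le_sharp` at `λ = θ/2`: an excess `≤ θ¹² L²` forces
`Σ_k t_k ≤ 8θ³L² + 3L`, and the pair Gram bound `Re⟨Δ_d†Δ_d⟩ ≤ 32L² + 32(Σ t)²` then caps the LRO
density below `4096 θ⁶ + 608/L²`). Bardeen–Cooper–Schrieffer (1957) §II. [folklore] -/
theorem freeDWavePairing_costs_energy_sharp_scale {θ : ℝ} (hθ : 0 < θ) (hθ1 : θ ≤ 1) (hL : 3 ≤ L)
    {a : ℝ} (ha : 8192 * θ ^ 6 ≤ a) (hLa : 1216 < a * L) {n : ℕ}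
    {ψ : Fock (Orb (FermionTorus 2 L))}
    (hψ : ψ ∈ szSector (Λ := FermionTorus 2 L) (2 * n) 0) (h1 : star ψ ⬝ᵥ ψ = 1)
    (hY : a * (L : ℝ) ^ 4 ≤
      (star ψ ⬝ᵥ (((pairField dWaveFormFactor L)ᴴ * pairField dWaveFormFactor L) *ᵥ ψ)).re) :
    (hubbardTorus 2 L 1 0).minEnergyOn (szSector (Λ := FermionTorus 2 L) (2 * n) 0) +
        θ ^ 12 * (L : ℝ) ^ 2 <
      (star ψ ⬝ᵥ (hubbardTorus 2 L 1 0 *ᵥ ψ)).re := by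
  set X : ℝ := (star ψ ⬝ᵥ (hubbardTorus 2 L 1 0 *ᵥ ψ)).re -
    (hubbardTorus 2 L 1 0).minEnergyOn (szSector (Λ := FermionTorus 2 L) (2 * n) 0) with hX
  by_contra hcon
  have hXle : X ≤ θ ^ 12 * (L : ℝ) ^ 2 := by rw [hX]; linarith
  set T : ℝ := ∑ k : TorusSite 2 L, Real.sqrt (Real.sqrt
        ((star ψ ⬝ᵥ ((momentumNumber k 0 * momentumNumber (-k) 1) *ᵥ ψ)).re *
          (star ψ ⬝ᵥ (((1 - momentumNumber k 0) * (1 - momentumNumber (-k) 1)) *ᵥ ψ)).re)) with hT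
  have hT0 : 0 ≤ T := Finset.sum_nonneg fun k _ => Real.sqrt_nonneg _
  have hL1 : (1 : ℝ) ≤ L := by exact_mod_cast (show 1 ≤ L by omega)
  have hL0 : (0 : ℝ) < L := by linarith
  have hθ3 : 0 < θ ^ 3 := by positivity
  -- the sharp quartic-mean bound at `λ = θ/2`
  have hTle : T ≤ 8 * θ ^ 3 * (L : ℝ) ^ 2 + 3 * L := by
    have h := sum_quarticMean_le_sharp hL hψ h1 hθ hθ1 (lam := θ / 2) (by positivity)
    rw [← hT, ← hX] at h
    have hfrac : X / (4 * (θ / 2) ^ 3 * θ ^ 6) ≤ 2 * θ ^ 3 * (L : ℝ) ^ 2 := by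
      rw [div_le_iff₀ (by positivity)]
      calc X ≤ θ ^ 12 * (L : ℝ) ^ 2 := hXle
        _ = 2 * θ ^ 3 * (L : ℝ) ^ 2 * (4 * (θ / 2) ^ 3 * θ ^ 6) := by ring
    have hlin : θ / 2 * (10 * θ ^ 2 * (L : ℝ) ^ 2 + 2 * L) ≤ 5 * θ ^ 3 * (L : ℝ) ^ 2 + L := by
      have : θ * (L : ℝ) ≤ L := by nlinarith
      nlinarith
    linarith
  have hY' := re_expect_pairField_dWave_le ψ h1
  rw [← hT] at hY'
  -- `a L⁴ ≤ 32 L² + 32 T² ≤ 4096 θ⁶ L⁴ + 608 L² ≤ (a/2) L⁴ + 608 L²`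
  have hT2 : T ^ 2 ≤ 128 * θ ^ 6 * (L : ℝ) ^ 4 + 18 * (L : ℝ) ^ 2 := by
    nlinarith [sq_nonneg (8 * θ ^ 3 * (L : ℝ) ^ 2 - 3 * L)]
  have hL4 : 0 < (L : ℝ) ^ 4 := by positivity
  have hmain : a * (L : ℝ) ^ 4 ≤ a / 2 * (L : ℝ) ^ 4 + 608 * (L : ℝ) ^ 2 := by nlinarith
  -- hence `a L² ≤ 1216`, contradicting `a L > 1216`
  have ha0 : 0 < a := lt_of_lt_of_le (by positivity) ha
  have hL2 : a * (L : ℝ) ^ 2 ≤ 1216 := by nlinarith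
  have : a * (L : ℝ) ≤ a * (L : ℝ) ^ 2 := by nlinarith
  linarith

/-- **`d`-wave pair LRO costs kinetic energy — sharp explicit constants.** For `a > 0`, `L ≥ 3`
with `a·L > 1216`, and a unit vector `ψ ∈ szSector (2n) 0` with `Re ⟨ψ, Δ_d†Δ_d ψ⟩ ≥ a·L⁴`:
`minEnergyOn H₀ (szSector (2n) 0) + (min(a,1)/8192)²·L² < Re ⟨ψ, H₀ ψ⟩`, `H₀ = hubbardTorus 2 L 1 0`
(the scale form at `θ = (min(a,1)/8192)^{1/6}`). The rate `η(a) = (min(a,1)/8192)²` is quadratic in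
the LRO density — the optimal power of the pair-Gram / bathtub method (profile `t_k ∝ |ξ_k|^{-1/3}`),
improving the sextic rate `4(min(a,1)/48)⁶` of `freeDWavePairing_costs_energy_explicit`.
Bardeen–Cooper–Schrieffer (1957) §II. [folklore] -/
theorem freeDWavePairing_costs_energy_sharp_explicit {a : ℝ} (ha : 0 < a) (hL : 3 ≤ L)
    (hLa : 1216 < a * L) {n : ℕ} {ψ : Fock (Orb (FermionTorus 2 L))}
    (hψ : ψ ∈ szSector (Λ := FermionTorus 2 L) (2 * n) 0) (h1 : star ψ ⬝ᵥ ψ = 1)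
    (hY : a * (L : ℝ) ^ 4 ≤
      (star ψ ⬝ᵥ (((pairField dWaveFormFactor L)ᴴ * pairField dWaveFormFactor L) *ᵥ ψ)).re) :
    (hubbardTorus 2 L 1 0).minEnergyOn (szSector (Λ := FermionTorus 2 L) (2 * n) 0) +
        (min a 1 / 8192) ^ 2 * (L : ℝ) ^ 2 <
      (star ψ ⬝ᵥ (hubbardTorus 2 L 1 0 *ᵥ ψ)).re := by
  set s : ℝ := min a 1 / 8192 with hs
  have hm0 : 0 < min a 1 := lt_min ha one_pos
  have hs0 : 0 < s := by rw [hs]; positivity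
  have hs1 : s ≤ 1 := by
    rw [hs, div_le_one (by norm_num)]
    linarith [min_le_right a 1]
  set θ : ℝ := s ^ ((1 : ℝ) / 6) with hθ
  have hθ0 : 0 < θ := Real.rpow_pos_of_pos hs0 _
  have hθ1 : θ ≤ 1 := Real.rpow_le_one hs0.le hs1 (by norm_num)
  have hθ6 : θ ^ 6 = s := by
    rw [hθ, ← Real.rpow_natCast, ← Real.rpow_mul hs0.le]
    norm_num
  have ha' : 8192 * θ ^ 6 ≤ a := by
    rw [hθ6, hs]
    linarith [min_le_left a 1]
  have h := freeDWavePairing_costs_energy_sharp_scale hθ0 hθ1 hL ha' hLa hψ h1 hY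
  have hθ12 : θ ^ 12 = s ^ 2 := by rw [show θ ^ 12 = (θ ^ 6) ^ 2 by ring, hθ6]
  rwa [hθ12] at h

/-- **`d`-wave pair LRO costs kinetic energy — the sharp rate at given side.** For `a > 0`, every
side `L ≥ ⌈1216/a⌉ + 3`, every `N` and every unit `ψ ∈ szSector N 0` with
`Re ⟨ψ, Δ_d†Δ_d ψ⟩ ≥ a·L⁴`: `minEnergyOn H₀ (szSector N 0) + (min(a,1)/8192)²·L² ≤ Re ⟨ψ, H₀ ψ⟩`
(`N` is even, or the sector is trivial). Same shape as `freeDWavePairing_costs_energy_rate`, so it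
plugs into every consumer of the sextic rate. Bardeen–Cooper–Schrieffer (1957) §II. [folklore] -/
theorem freeDWavePairing_costs_energy_sharp_rate {a : ℝ} (ha : 0 < a) {L : ℕ} [NeZero L]
    (hL : ⌈1216 / a⌉₊ + 3 ≤ L) {N : ℕ} {ψ : Fock (Orb (FermionTorus 2 L))}
    (hψ : ψ ∈ szSector (Λ := FermionTorus 2 L) N 0) (h1 : star ψ ⬝ᵥ ψ = 1)
    (hY : a * (L : ℝ) ^ 4 ≤
      (star ψ ⬝ᵥ (((pairField dWaveFormFactor L)ᴴ * pairField dWaveFormFactor L) *ᵥ ψ)).re) :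
    (hubbardTorus 2 L 1 0).minEnergyOn (szSector (Λ := FermionTorus 2 L) N 0) +
        (min a 1 / 8192) ^ 2 * (L : ℝ) ^ 2 ≤
      (star ψ ⬝ᵥ (hubbardTorus 2 L 1 0 *ᵥ ψ)).re := by
  have hL3 : 3 ≤ L := by omega
  have hLa : 1216 < a * L := by
    have hceil : 1216 / a ≤ (⌈1216 / a⌉₊ : ℝ) := Nat.le_ceil _
    have hL' : (⌈1216 / a⌉₊ : ℝ) + 3 ≤ (L : ℝ) := by exact_mod_cast hL
    have : 1216 / a < (L : ℝ) := by linarith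
    rwa [div_lt_iff₀' ha] at this
  have h0 : ψ ≠ 0 := by rintro rfl; simp at h1
  obtain ⟨n, rfl⟩ := exists_eq_two_mul_of_mem_szSector_zero hψ h0
  exact le_of_lt (freeDWavePairing_costs_energy_sharp_explicit ha hL3 hLa hψ h1 hY)

/-- **A-priori form: small kinetic excess carries little `d`-wave pair order.** For `a > 0`,
`L ≥ 3` with `a·L > 1216`, and a unit `ψ ∈ szSector (2n) 0` whose free kinetic energy is within
`(min(a,1)/8192)²·L²` of the free sector ground energy: `Re ⟨ψ, Δ_d†Δ_d ψ⟩ < a·L⁴`. Equivalently,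
an excess density `e = X/L²` allows a `d`-wave pair density of at most `max(8192·√e, 1)` (up to
the finite-size threshold). Bardeen–Cooper–Schrieffer (1957) §II. [folklore] -/
theorem re_expect_pairField_dWave_lt_of_energy_excess_le {a : ℝ} (ha : 0 < a) (hL : 3 ≤ L)
    (hLa : 1216 < a * L) {n : ℕ} {ψ : Fock (Orb (FermionTorus 2 L))}
    (hψ : ψ ∈ szSector (Λ := FermionTorus 2 L) (2 * n) 0) (h1 : star ψ ⬝ᵥ ψ = 1)
    (hX : (star ψ ⬝ᵥ (hubbardTorus 2 L 1 0 *ᵥ ψ)).re ≤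
      (hubbardTorus 2 L 1 0).minEnergyOn (szSector (Λ := FermionTorus 2 L) (2 * n) 0) +
        (min a 1 / 8192) ^ 2 * (L : ℝ) ^ 2) :
    (star ψ ⬝ᵥ (((pairField dWaveFormFactor L)ᴴ * pairField dWaveFormFactor L) *ᵥ ψ)).re <
      a * (L : ℝ) ^ 4 := by
  by_contra h
  push Not at h
  have := freeDWavePairing_costs_energy_sharp_explicit ha hL hLa hψ h1 h
  linarith

end Assembly

end Literature.MathematicalPhysics.QuantumLattice
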